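import Literature.MathematicalPhysics.QuantumFieldTheory.Balaban1983to89.Beta.PlaquetteStencil

/-!
# PlaquetteStencilData — the Wilson action's first-order vertex family is ONE finite stencil with explicit, site-independent data

(v1.0.1: module docstring only — the two cell sentences below added at the referee's advisory A-R371 / REFEREE-BETA R398; every
declaration byte-identical to v1.)

HONEST FRAMING (cell `pub-balaban`, β sub-cell, lineage an3; verbatim): discharging `BetaPertH` makes Bałaban's UV stability
UNCONDITIONAL — a real constructive-QFT result; it is NOT the continuum limit and NOT the Clay problem.  This file discharges NOTHING
of `BetaPertH`: it is finite stencil bookkeeping of the Wilson action's exact first-order background vertex.  ABSOLUTE RULE of the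
cell: no internally minted statement enters as a cited fact; every declaration below is a definition or is kernel-proved here from the
single import; NOTHING is cited.  The manuscripts under audit are not citable for their disputed steps and are not cited here.

`PlaquetteStencil.wilsonVertex₁ e z γ A` (the exact `B`-linear one-bond Hessian vertex of the Wilson action at the background bond
`(z, γ)` with colour matrix `A`, headline `PlaquetteStencil.actionJet21_eq_wilsonVertex₁`) is written here in the STENCIL FORMAT of
`BubbleTable` (an2): `stencilIns z S α β m = Σ_{s ∈ S} E_{z + α s, z + β s} ⊗ m s`, with index set `S = univ` over an explicit finite
type and with offset / colour-block data `wα e γ`, `wβ e γ`, `wm γ A` that DO NOT DEPEND ON THE SITE `z`: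

  `wilsonVertex₁ e z γ A = stencilIns z univ (wα e γ) (wβ e γ) (wm γ A)`      (`wilsonVertex₁_eq_stencil`).

This is exactly the hypothesis `hV : ∀ z, V z = stencilIns z S α β m` under which `BubbleTable`'s table theorems
(`bubble_stencil_eq_table`, `polarization_translate`, …) apply verbatim, and it carries the two structural facts a one-step kernel
construction needs about the vertex family: FINITE RANGE (an entry `((x,·),(y,·))` vanishes unless `x − z` is one of the row offsets
`wα e γ i` and `y − z` one of the column offsets `wβ e γ i`; `wilsonVertex₁_apply_eq_zero_of_row/col`) and LATTICE-TRANSLATION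
COVARIANCE (`wilsonVertex₁_translate`).  THE OFFSET ALPHABET THEOREM (`isOffset_wα`, `isOffset_wβ`): every row offset and every
column offset in the tables equals one of `0, e γ, e μ, −e μ, e γ − e μ` (`μ : D`) — a signed combination of at most two lattice
vectors — so a non-zero entry of `wilsonVertex₁ e z γ A` sits at a pair of sites `(z + x, z + y)` with `x, y` in that alphabet
(`wilsonVertex₁_apply_ne_zero`).

## Contents

* §1 STENCIL ALGEBRA for `BubbleTable.stencilIns` over `univ`: closure under `+` (index `σ ⊕ σ′`), scalars, negation, `−`, finite sums
  (index `ι × σ`), re-basing `z ± c ↦ z`; entries, vanishing off the stencil, translation.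
* §2 DATA AND STENCIL FORMS OF THE CONSTITUENTS: the longitudinal vertex `divVertex` (index `D × Bool`), the plaquette insertions
  `farIns` (`Bool`), `transportIns` (`Fin 8`), `diffIns` (`Fin 12`) at a base site, the one-bond sum `bondSum` of any based stencil family
  (index `D × (Fin 4 × σ)`), hence `spinFarDiffVertex`, `transportFVertex`, `spinDiffVertex`, the remainder vertex `remVertex₁`, the model
  vector vertex `SpinTable.vecVertex` (from `GhostTable.current_eq_stencil` and `SpinTable.spinVertex_eq_stencil`), and the headline.
* §3 THE OFFSET ALPHABET `IsOffset e γ x :⇔ x ∈ {0, e γ, e μ, −e μ, e γ − e μ}`: every row offset `wα e γ i` and every column offset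
  `wβ e γ i` lies in it (`isOffset_wα`, `isOffset_wβ`; finite case analysis of the tables).
* §4 COROLLARIES: entries, finite range (`wilsonVertex₁_apply_eq_zero_of_row/col`, `wilsonVertex₁_apply_ne_zero`: a non-zero entry
  sits at `(z + x, z + y)` with `x, y` in the alphabet), translation covariance (`wilsonVertex₁_translate`) of `wilsonVertex₁`.

Gloss.  Pure finite bookkeeping over an arbitrary additive group of sites `Λ` (no finiteness of `Λ` is used), any colour index type
`C` and a finite direction type `D`; nothing is estimated and NOTHING IS CITED — every declaration is tagged `[folklore]`.  NOT PROVED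
HERE, NOT CLAIMED: any table value or bound of the vertex, anything about the second-order `(2,2)` family, `BetaPertH`, the continuum
limit or the Clay problem.
-/

namespace Literature.MathematicalPhysics.QuantumFieldTheory.Balaban1983to89.Beta.PlaquetteStencilData

open Finset
open scoped BigOperators Matrix
open Literature.MathematicalPhysics.QuantumFieldTheory.Balaban1983to89.Beta.BubbleTable (elemIns elemIns_apply stencilIns)
open Literature.MathematicalPhysics.QuantumFieldTheory.Balaban1983to89.Beta.GhostTable (current copies curα curβ curM current_eq_stencil
  elemIns_neg elemIns_smul)
open Literature.MathematicalPhysics.QuantumFieldTheory.Balaban1983to89.Beta.SpinTable (spinVertex vecVertex spinMat spα spM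
  spinVertex_eq_stencil)
open Literature.MathematicalPhysics.QuantumFieldTheory.Balaban1983to89.Beta.PlaquetteWeitzenbock (sTot)
open Literature.MathematicalPhysics.QuantumFieldTheory.Balaban1983to89.Beta.PlaquetteStencil

/-! ## §1 Stencil algebra -/

section Algebra

variable {Λ : Type*} [DecidableEq Λ] [AddCommGroup Λ] {X : Type*} {σ σ' ι : Type*}

/-- SUM of two stencils at the same site: index type `σ ⊕ σ′`, data `Sum.elim`. [folklore] -/
theorem stencilIns_add [Fintype σ] [Fintype σ'] (z : Λ) (α β : σ → Λ) (m : σ → Matrix X X ℝ) (α' β' : σ' → Λ)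
    (m' : σ' → Matrix X X ℝ) :
    stencilIns z univ α β m + stencilIns z univ α' β' m' = stencilIns z univ (Sum.elim α α') (Sum.elim β β') (Sum.elim m m') := by
  simp only [stencilIns, Fintype.sum_sum_type, Sum.elim_inl, Sum.elim_inr]

/-- SCALARS move into the colour blocks. [folklore] -/
theorem stencilIns_smul (z : Λ) (S : Finset σ) (α β : σ → Λ) (m : σ → Matrix X X ℝ) (c : ℝ) :
    c • stencilIns z S α β m = stencilIns z S α β (c • m) := by
  simp only [stencilIns, Finset.smul_sum, Pi.smul_apply, elemIns_smul]

/-- NEGATION moves into the colour blocks. [folklore] -/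
theorem stencilIns_neg (z : Λ) (S : Finset σ) (α β : σ → Λ) (m : σ → Matrix X X ℝ) :
    -stencilIns z S α β m = stencilIns z S α β (-m) := by
  simp only [stencilIns, Pi.neg_apply, elemIns_neg, Finset.sum_neg_distrib]

/-- DIFFERENCE of two stencils at the same site. [folklore] -/
theorem stencilIns_sub [Fintype σ] [Fintype σ'] (z : Λ) (α β : σ → Λ) (m : σ → Matrix X X ℝ) (α' β' : σ' → Λ)
    (m' : σ' → Matrix X X ℝ) :
    stencilIns z univ α β m - stencilIns z univ α' β' m' = stencilIns z univ (Sum.elim α α') (Sum.elim β β') (Sum.elim m (-m')) := by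
  rw [sub_eq_add_neg, stencilIns_neg, stencilIns_add]

/-- FINITE SUM of stencils at the same site: index type `ι × σ`. [folklore] -/
theorem stencilIns_sum [Fintype ι] [Fintype σ] (z : Λ) (α β : ι → σ → Λ) (m : ι → σ → Matrix X X ℝ) :
    ∑ i, stencilIns z univ (α i) (β i) (m i) =
      stencilIns z univ (fun p : ι × σ => α p.1 p.2) (fun p => β p.1 p.2) (fun p => m p.1 p.2) := by
  simp only [stencilIns, Fintype.sum_prod_type]

/-- RE-BASING a stencil written at `z + c` to the site `z`: offsets shift by `c`. [folklore] -/
theorem stencilIns_rebase_add (z c : Λ) (S : Finset σ) (α β : σ → Λ) (m : σ → Matrix X X ℝ) :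
    stencilIns (z + c) S α β m = stencilIns z S (fun s => c + α s) (fun s => c + β s) m := by
  simp only [stencilIns, add_assoc]

/-- RE-BASING a stencil written at `z − c` to the site `z`: offsets shift by `−c`. [folklore] -/
theorem stencilIns_rebase_sub (z c : Λ) (S : Finset σ) (α β : σ → Λ) (m : σ → Matrix X X ℝ) :
    stencilIns (z - c) S α β m = stencilIns z S (fun s => -c + α s) (fun s => -c + β s) m := by
  simp only [stencilIns, sub_eq_add_neg, add_assoc]

/-- ENTRIES of a stencil. [folklore] -/
theorem stencilIns_apply (z : Λ) (S : Finset σ) (α β : σ → Λ) (m : σ → Matrix X X ℝ) (p q : Λ × X) :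
    stencilIns z S α β m p q = ∑ s ∈ S, if p.1 = z + α s ∧ q.1 = z + β s then m s p.2 q.2 else 0 := by
  simp only [stencilIns, Matrix.sum_apply]
  rfl

/-- FINITE RANGE (rows): an entry whose row site is none of the `z + α s` vanishes. [folklore] -/
theorem stencilIns_apply_eq_zero_of_row (z : Λ) (S : Finset σ) (α β : σ → Λ) (m : σ → Matrix X X ℝ) {p : Λ × X} (q : Λ × X)
    (h : ∀ s ∈ S, p.1 ≠ z + α s) : stencilIns z S α β m p q = 0 := by
  rw [stencilIns_apply]
  exact Finset.sum_eq_zero fun s hs => if_neg fun hc => h s hs hc.1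

/-- FINITE RANGE (columns): an entry whose column site is none of the `z + β s` vanishes. [folklore] -/
theorem stencilIns_apply_eq_zero_of_col (z : Λ) (S : Finset σ) (α β : σ → Λ) (m : σ → Matrix X X ℝ) (p : Λ × X) {q : Λ × X}
    (h : ∀ s ∈ S, q.1 ≠ z + β s) : stencilIns z S α β m p q = 0 := by
  rw [stencilIns_apply]
  exact Finset.sum_eq_zero fun s hs => if_neg fun hc => h s hs hc.2

/-- TRANSLATION COVARIANCE: the stencil at `z + a` is the stencil at `z` read at the back-translated sites. [folklore] -/
theorem stencilIns_translate (z a : Λ) (S : Finset σ) (α β : σ → Λ) (m : σ → Matrix X X ℝ) (p q : Λ × X) :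
    stencilIns (z + a) S α β m p q = stencilIns z S α β m (p.1 - a, p.2) (q.1 - a, q.2) := by
  rw [stencilIns_apply, stencilIns_apply]
  refine Finset.sum_congr rfl fun s _ => ?_
  simp only [sub_eq_iff_eq_add, add_right_comm z a]

end Algebra

/-! ## §2 Stencil data and stencil forms of the constituents of the Wilson vertex -/

section Data

variable {Λ : Type*} [DecidableEq Λ] [AddCommGroup Λ] {C : Type*} {D : Type*} [Fintype D] [DecidableEq D]

/-- column offsets of the longitudinal vertex `divVertex`: `e γ` (paired block `+`) and `e γ − e μ` (paired block `−`); all its row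
offsets are `0`.  A definition asserting nothing. [folklore] -/
def dvβ (e : D → Λ) (γ : D) : D × Bool → Λ := fun p => if p.2 then e γ else e γ - e p.1

/-- colour blocks of `divVertex`: `± dirBlock γ μ A`.  A definition asserting nothing. [folklore] -/
def dvm (γ : D) (A : Matrix C C ℝ) : D × Bool → Matrix (C × D) (C × D) ℝ :=
  fun p => if p.2 then dirBlock γ p.1 A else -dirBlock γ p.1 A

/-- **THE LONGITUDINAL VERTEX IS A STENCIL** (index `D × Bool`). [folklore] -/
theorem divVertex_eq_stencil (e : D → Λ) (z : Λ) (γ : D) (A : Matrix C C ℝ) :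
    divVertex e z γ A = stencilIns z univ (fun _ => (0 : Λ)) (dvβ e γ) (dvm γ A) := by
  simp only [divVertex, stencilIns, Fintype.sum_prod_type, Fintype.sum_bool, dvβ, dvm, if_true, Bool.false_eq_true, if_false,
    add_zero, pairIns, elemIns_neg, sub_eq_add_neg, add_assoc]

/-- row offsets of the far-corner insertion `farIns e s α β` at its base site `s`: `e β`, `0`.  A definition asserting nothing. [folklore] -/
def faα (e : D → Λ) (_α β : D) : Bool → Λ := fun b => if b then e β else 0

/-- column offsets of `farIns`: `e α`, `0`.  A definition asserting nothing. [folklore] -/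
def faβ (e : D → Λ) (α _β : D) : Bool → Λ := fun b => if b then e α else 0

/-- colour blocks of `farIns`: `± dirBlock α β A`.  A definition asserting nothing. [folklore] -/
def fam (α β : D) (A : Matrix C C ℝ) : Bool → Matrix (C × D) (C × D) ℝ := fun b => if b then dirBlock α β A else -dirBlock α β A

omit [Fintype D] in
/-- **THE FAR-CORNER INSERTION IS A STENCIL** at its base site (index `Bool`). [folklore] -/
theorem farIns_eq_stencil (e : D → Λ) (s : Λ) (α β : D) (A : Matrix C C ℝ) :
    farIns e s α β A = stencilIns s univ (faα e α β) (faβ e α β) (fam α β A) := by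
  simp only [farIns, stencilIns, Fintype.sum_bool, faα, faβ, fam, if_true, Bool.false_eq_true, if_false, add_zero, pairIns,
    elemIns_neg, sub_eq_add_neg]

/-- row offsets of the transport insertion `transportIns e s α β` at its base site (its `8` located pairs in the order of the
definition): `e β, e β, e β, e β, 0, 0, 0, 0`.  A definition asserting nothing. [folklore] -/
def trα (e : D → Λ) (_α β : D) : Fin 8 → Λ := ![e β, e β, e β, e β, 0, 0, 0, 0]

/-- column offsets of `transportIns`: `e α, 0, e β, 0, e α, 0, e β, 0`.  A definition asserting nothing. [folklore] -/
def trβ (e : D → Λ) (α β : D) : Fin 8 → Λ := ![e α, 0, e β, 0, e α, 0, e β, 0]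

/-- colour blocks of `transportIns` (signs as in the definition).  A definition asserting nothing. [folklore] -/
def trm (α β : D) (A : Matrix C C ℝ) : Fin 8 → Matrix (C × D) (C × D) ℝ :=
  ![dirBlock α β A, -dirBlock α β A, -dirBlock α α A, dirBlock α α A, dirBlock β β A, -dirBlock β β A, -dirBlock β α A,
    dirBlock β α A]

omit [Fintype D] in
/-- **THE TRANSPORT INSERTION IS A STENCIL** at its base site (index `Fin 8`). [folklore] -/
theorem transportIns_eq_stencil (e : D → Λ) (s : Λ) (α β : D) (A : Matrix C C ℝ) :
    transportIns e s α β A = stencilIns s univ (trα e α β) (trβ e α β) (trm α β A) := by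
  simp only [transportIns, stencilIns, Fin.sum_univ_succ, Fin.sum_univ_zero, trα, trβ, trm, Matrix.cons_val_zero,
    Matrix.cons_val_succ, add_zero, pairIns, elemIns_neg, sub_eq_add_neg]
  abel

/-- row offsets of the difference insertion `diffIns e s α β` at its base site (its located pairs in the order of the definition, the
scalar `2` distributed): `0` eight times, then `e α, e α, 0, 0`.  A definition asserting nothing. [folklore] -/
def diα (e : D → Λ) (α _β : D) : Fin 12 → Λ := ![0, 0, 0, 0, 0, 0, 0, 0, e α, e α, 0, 0]

/-- column offsets of `diffIns`: `e α, 0, e β, 0, e β, 0, e α, 0, e β, 0, e β, 0`.  A definition asserting nothing. [folklore] -/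
def diβ (e : D → Λ) (α β : D) : Fin 12 → Λ := ![e α, 0, e β, 0, e β, 0, e α, 0, e β, 0, e β, 0]

/-- colour blocks of `diffIns` (coefficients `±2, ±1` as in the definition).  A definition asserting nothing. [folklore] -/
def dim (α β : D) (A : Matrix C C ℝ) : Fin 12 → Matrix (C × D) (C × D) ℝ :=
  ![(2 : ℝ) • dirBlock α β A, -((2 : ℝ) • dirBlock α β A), -((2 : ℝ) • dirBlock β α A), (2 : ℝ) • dirBlock β α A,
    -dirBlock α α A, dirBlock α α A, dirBlock β β A, -dirBlock β β A,
    -dirBlock β α A, dirBlock β α A, dirBlock β α A, -dirBlock β α A]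

omit [Fintype D] in
/-- **THE DIFFERENCE INSERTION IS A STENCIL** at its base site (index `Fin 12`). [folklore] -/
theorem diffIns_eq_stencil (e : D → Λ) (s : Λ) (α β : D) (A : Matrix C C ℝ) :
    diffIns e s α β A = stencilIns s univ (diα e α β) (diβ e α β) (dim α β A) := by
  simp only [diffIns, stencilIns, Fin.sum_univ_succ, Fin.sum_univ_zero, diα, diβ, dim, Matrix.cons_val_zero, Matrix.cons_val_succ,
    add_zero, pairIns, elemIns_neg, elemIns_smul, smul_add, smul_neg, sub_eq_add_neg]
  abel

/-- base offsets of the four readings of the one-bond sum `bondSum e z γ K = Σ_μ (K(z−e_μ) μ γ − K z μ γ − K(z−e_μ) γ μ + K z γ μ)`: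
`−e μ, 0, −e μ, 0`.  A definition asserting nothing. [folklore] -/
def boff (e : D → Λ) (μ : D) : Fin 4 → Λ := ![-e μ, 0, -e μ, 0]

/-- first direction of the four readings: `μ, μ, γ, γ`.  A definition asserting nothing. [folklore] -/
def bd₁ (μ γ : D) : Fin 4 → D := ![μ, μ, γ, γ]

/-- second direction of the four readings: `γ, γ, μ, μ`.  A definition asserting nothing. [folklore] -/
def bd₂ (μ γ : D) : Fin 4 → D := ![γ, γ, μ, μ]

/-- signs of the four readings: `+, −, −, +`.  A definition asserting nothing. [folklore] -/
def bsgn : Fin 4 → ℝ := ![1, -1, -1, 1]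

variable {σ : Type*}

/-- row offsets of the one-bond sum of a based stencil family with row data `kα`: base offset plus the family's offset at the reading's
directions.  A definition asserting nothing. [folklore] -/
def bsα (e : D → Λ) (γ : D) (kα : D → D → σ → Λ) : D × (Fin 4 × σ) → Λ :=
  fun p => boff e p.1 p.2.1 + kα (bd₁ p.1 γ p.2.1) (bd₂ p.1 γ p.2.1) p.2.2

/-- column offsets of the one-bond sum of a based stencil family with column data `kβ`.  A definition asserting nothing. [folklore] -/
def bsβ (e : D → Λ) (γ : D) (kβ : D → D → σ → Λ) : D × (Fin 4 × σ) → Λ :=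
  fun p => boff e p.1 p.2.1 + kβ (bd₁ p.1 γ p.2.1) (bd₂ p.1 γ p.2.1) p.2.2

/-- colour blocks of the one-bond sum of a based stencil family with block data `km`: the reading's sign times the family's block.
A definition asserting nothing. [folklore] -/
def bsm (γ : D) (km : D → D → σ → Matrix (C × D) (C × D) ℝ) : D × (Fin 4 × σ) → Matrix (C × D) (C × D) ℝ :=
  fun p => bsgn p.2.1 • km (bd₁ p.1 γ p.2.1) (bd₂ p.1 γ p.2.1) p.2.2

omit [DecidableEq D] in
/-- **THE ONE-BOND SUM OF A BASED STENCIL FAMILY IS A STENCIL** (index `D × (Fin 4 × σ)`): if `K s α β = stencilIns s univ (kα α β)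
(kβ α β) (km α β)` for every base site `s` with `s`-independent data, then `bondSum e z γ K` is the stencil at `z` with data
`bsα, bsβ, bsm`. [folklore] -/
theorem bondSum_eq_stencil [Fintype σ] (e : D → Λ) (z : Λ) (γ : D) (K : Λ → D → D → Matrix (Λ × (C × D)) (Λ × (C × D)) ℝ)
    (kα kβ : D → D → σ → Λ) (km : D → D → σ → Matrix (C × D) (C × D) ℝ)
    (hK : ∀ s α β, K s α β = stencilIns s univ (kα α β) (kβ α β) (km α β)) :
    bondSum e z γ K = stencilIns z univ (bsα e γ kα) (bsβ e γ kβ) (bsm γ km) := by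
  rw [bondSum, stencilIns, Fintype.sum_prod_type]
  refine Finset.sum_congr rfl fun μ _ => ?_
  rw [hK, hK, hK, hK, stencilIns_rebase_sub, stencilIns_rebase_sub]
  simp only [stencilIns, Fintype.sum_prod_type, Fin.sum_univ_succ, Fin.sum_univ_zero, bsα, bsβ, bsm, boff, bd₁, bd₂, bsgn,
    Matrix.cons_val_zero, Matrix.cons_val_succ, one_smul, neg_smul, elemIns_neg, Finset.sum_neg_distrib, zero_add, add_zero,
    sub_eq_add_neg, add_assoc]

/-- **THE FAR-CORNER SPIN-DIFFERENCE VERTEX IS A STENCIL**. [folklore] -/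
theorem spinFarDiffVertex_eq_stencil (e : D → Λ) (z : Λ) (γ : D) (A : Matrix C C ℝ) :
    spinFarDiffVertex e z γ A = stencilIns z univ (bsα e γ (faα e)) (bsβ e γ (faβ e)) (bsm γ fun α β => fam α β A) := by
  rw [spinFarDiffVertex]
  exact bondSum_eq_stencil e z γ _ (faα e) (faβ e) (fun α β => fam α β A) fun s α β => farIns_eq_stencil e s α β A

/-- **THE TRANSPORT `F`-VERTEX IS A STENCIL**. [folklore] -/
theorem transportFVertex_eq_stencil (e : D → Λ) (z : Λ) (γ : D) (A : Matrix C C ℝ) :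
    transportFVertex e z γ A = stencilIns z univ (bsα e γ (trα e)) (bsβ e γ (trβ e)) (bsm γ fun α β => trm α β A) := by
  rw [transportFVertex]
  exact bondSum_eq_stencil e z γ _ (trα e) (trβ e) (fun α β => trm α β A) fun s α β => transportIns_eq_stencil e s α β A

/-- **THE SPIN-DIFFERENCE VERTEX IS A STENCIL**. [folklore] -/
theorem spinDiffVertex_eq_stencil (e : D → Λ) (z : Λ) (γ : D) (A : Matrix C C ℝ) :
    spinDiffVertex e z γ A = stencilIns z univ (bsα e γ (diα e)) (bsβ e γ (diβ e)) (bsm γ fun α β => dim α β A) := by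
  rw [spinDiffVertex]
  exact bondSum_eq_stencil e z γ _ (diα e) (diβ e) (fun α β => dim α β A) fun s α β => diffIns_eq_stencil e s α β A

/-- index type of the remainder vertex's stencil.  A definition asserting nothing. [folklore] -/
abbrev RemIdx (D : Type*) := (D × (Fin 4 × Fin 12) ⊕ D × (Fin 4 × Fin 8)) ⊕ D × (Fin 4 × Bool)

/-- row offsets of the remainder vertex `remVertex₁ = −½•spinDiffVertex + transportFVertex − spinFarDiffVertex`.  A definition asserting
nothing. [folklore] -/
def rmα (e : D → Λ) (γ : D) : RemIdx D → Λ := Sum.elim (Sum.elim (bsα e γ (diα e)) (bsα e γ (trα e))) (bsα e γ (faα e))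

/-- column offsets of the remainder vertex.  A definition asserting nothing. [folklore] -/
def rmβ (e : D → Λ) (γ : D) : RemIdx D → Λ := Sum.elim (Sum.elim (bsβ e γ (diβ e)) (bsβ e γ (trβ e))) (bsβ e γ (faβ e))

/-- colour blocks of the remainder vertex (`−½`, `+1`, `−1` times the three families' blocks).  A definition asserting nothing. [folklore] -/
noncomputable def rmm (γ : D) (A : Matrix C C ℝ) : RemIdx D → Matrix (C × D) (C × D) ℝ :=
  Sum.elim (Sum.elim (-((2 : ℝ)⁻¹ • bsm γ fun α β => dim α β A)) (bsm γ fun α β => trm α β A)) (-bsm γ fun α β => fam α β A)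

/-- **THE REMAINDER VERTEX IS A STENCIL** (index `RemIdx D`). [folklore] -/
theorem remVertex₁_eq_stencil (e : D → Λ) (z : Λ) (γ : D) (A : Matrix C C ℝ) :
    remVertex₁ e z γ A = stencilIns z univ (rmα e γ) (rmβ e γ) (rmm γ A) := by
  rw [remVertex₁, spinDiffVertex_eq_stencil, transportFVertex_eq_stencil, spinFarDiffVertex_eq_stencil, stencilIns_smul,
    stencilIns_neg, stencilIns_add, stencilIns_sub]
  rfl

/-- **THE MODEL VECTOR VERTEX IS A STENCIL** (index `Bool ⊕ D × Bool`): `GhostTable.current_eq_stencil` for the copies plus `s` times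
`SpinTable.spinVertex_eq_stencil`. [folklore] -/
theorem vecVertex_eq_stencil (s : ℝ) (e : D → Λ) (z : Λ) (γ : D) (A : Matrix C C ℝ) :
    vecVertex s e z γ A =
      stencilIns z univ (Sum.elim (curα (e γ)) (spα e)) (Sum.elim (curβ (e γ)) (spα e))
        (Sum.elim (curM (copies D A)) (s • spM γ A)) := by
  rw [vecVertex, current_eq_stencil, spinVertex_eq_stencil, stencilIns_smul, stencilIns_add]

/-- index type of the Wilson vertex's stencil: (current ⊕ spin) ⊕ longitudinal ⊕ remainder.  A definition asserting nothing. [folklore] -/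
abbrev WilsonIdx (D : Type*) := ((Bool ⊕ D × Bool) ⊕ D × Bool) ⊕ RemIdx D

/-- ROW OFFSETS of the Wilson first-order vertex.  A definition asserting nothing. [folklore] -/
def wα (e : D → Λ) (γ : D) : WilsonIdx D → Λ :=
  Sum.elim (Sum.elim (Sum.elim (curα (e γ)) (spα e)) fun _ => 0) (rmα e γ)

/-- COLUMN OFFSETS of the Wilson first-order vertex.  A definition asserting nothing. [folklore] -/
def wβ (e : D → Λ) (γ : D) : WilsonIdx D → Λ :=
  Sum.elim (Sum.elim (Sum.elim (curβ (e γ)) (spα e)) (dvβ e γ)) (rmβ e γ)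

/-- COLOUR BLOCKS of the Wilson first-order vertex (`copies`, `sTot • spinMat`, `2 • dirBlock`, remainder blocks).  A definition
asserting nothing. [folklore] -/
noncomputable def wm (γ : D) (A : Matrix C C ℝ) : WilsonIdx D → Matrix (C × D) (C × D) ℝ :=
  Sum.elim (Sum.elim (Sum.elim (curM (copies D A)) (sTot • spM γ A)) ((2 : ℝ) • dvm γ A)) (rmm γ A)

/-- **HEADLINE — THE WILSON FIRST-ORDER VERTEX FAMILY IS ONE FINITE STENCIL WITH SITE-INDEPENDENT DATA**:
`wilsonVertex₁ e z γ A = stencilIns z univ (wα e γ) (wβ e γ) (wm γ A)` for every site `z`. [folklore] -/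
theorem wilsonVertex₁_eq_stencil (e : D → Λ) (z : Λ) (γ : D) (A : Matrix C C ℝ) :
    wilsonVertex₁ e z γ A = stencilIns z univ (wα e γ) (wβ e γ) (wm γ A) := by
  rw [wilsonVertex₁, vecVertex_eq_stencil, divVertex_eq_stencil, remVertex₁_eq_stencil, stencilIns_smul, stencilIns_add,
    stencilIns_add]
  rfl

end Data

/-! ## §3 The offset alphabet: every row / column offset of the Wilson stencil is one of `0, e γ, e μ, −e μ, e γ − e μ` -/

section Offsets

variable {Λ : Type*} [AddCommGroup Λ] {D : Type*}

/-- THE OFFSET ALPHABET of the bond direction `γ`: `x` is one of `0`, `e γ`, `e μ`, `−e μ`, `e γ − e μ` (`μ` any direction) — a signed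
combination of at most two lattice vectors.  A definition asserting nothing. [folklore] -/
def IsOffset (e : D → Λ) (γ : D) (x : Λ) : Prop := x = 0 ∨ x = e γ ∨ ∃ μ, x = e μ ∨ x = -e μ ∨ x = e γ - e μ

/-- `0` is in the alphabet. [folklore] -/
@[simp] theorem isOffset_zero (e : D → Λ) (γ : D) : IsOffset e γ 0 := Or.inl rfl

/-- `e γ` is in the alphabet. [folklore] -/
@[simp] theorem isOffset_self (e : D → Λ) (γ : D) : IsOffset e γ (e γ) := Or.inr (Or.inl rfl)

/-- `e μ` is in the alphabet. [folklore] -/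
@[simp] theorem isOffset_dir (e : D → Λ) (γ μ : D) : IsOffset e γ (e μ) := Or.inr (Or.inr ⟨μ, Or.inl rfl⟩)

/-- `−e μ` is in the alphabet. [folklore] -/
@[simp] theorem isOffset_neg (e : D → Λ) (γ μ : D) : IsOffset e γ (-e μ) := Or.inr (Or.inr ⟨μ, Or.inr (Or.inl rfl)⟩)

/-- `e γ − e μ` is in the alphabet. [folklore] -/
@[simp] theorem isOffset_sub (e : D → Λ) (γ μ : D) : IsOffset e γ (e γ - e μ) := Or.inr (Or.inr ⟨μ, Or.inr (Or.inr rfl)⟩)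

/-- `−e μ + e γ` is in the alphabet. [folklore] -/
@[simp] theorem isOffset_neg_add (e : D → Λ) (γ μ : D) : IsOffset e γ (-e μ + e γ) := by
  rw [neg_add_eq_sub]
  exact isOffset_sub e γ μ

/-- row offsets of the one-bond sum over the difference insertions lie in the alphabet. [folklore] -/
theorem isOffset_bsα_di (e : D → Λ) (γ μ : D) (j : Fin 4) (i : Fin 12) :
    IsOffset e γ (boff e μ j + diα e (bd₁ μ γ j) (bd₂ μ γ j) i) := by
  fin_cases j <;> fin_cases i <;> simp [boff, diα, bd₁]

/-- column offsets of the one-bond sum over the difference insertions lie in the alphabet. [folklore] -/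
theorem isOffset_bsβ_di (e : D → Λ) (γ μ : D) (j : Fin 4) (i : Fin 12) :
    IsOffset e γ (boff e μ j + diβ e (bd₁ μ γ j) (bd₂ μ γ j) i) := by
  fin_cases j <;> fin_cases i <;> simp [boff, diβ, bd₁, bd₂]

/-- row offsets of the one-bond sum over the transport insertions lie in the alphabet. [folklore] -/
theorem isOffset_bsα_tr (e : D → Λ) (γ μ : D) (j : Fin 4) (i : Fin 8) :
    IsOffset e γ (boff e μ j + trα e (bd₁ μ γ j) (bd₂ μ γ j) i) := by
  fin_cases j <;> fin_cases i <;> simp [boff, trα, bd₂]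

/-- column offsets of the one-bond sum over the transport insertions lie in the alphabet. [folklore] -/
theorem isOffset_bsβ_tr (e : D → Λ) (γ μ : D) (j : Fin 4) (i : Fin 8) :
    IsOffset e γ (boff e μ j + trβ e (bd₁ μ γ j) (bd₂ μ γ j) i) := by
  fin_cases j <;> fin_cases i <;> simp [boff, trβ, bd₁, bd₂]

/-- row offsets of the one-bond sum over the far-corner insertions lie in the alphabet. [folklore] -/
theorem isOffset_bsα_fa (e : D → Λ) (γ μ : D) (j : Fin 4) (b : Bool) :
    IsOffset e γ (boff e μ j + faα e (bd₁ μ γ j) (bd₂ μ γ j) b) := by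
  fin_cases j <;> cases b <;> simp [boff, faα, bd₂]

/-- column offsets of the one-bond sum over the far-corner insertions lie in the alphabet. [folklore] -/
theorem isOffset_bsβ_fa (e : D → Λ) (γ μ : D) (j : Fin 4) (b : Bool) :
    IsOffset e γ (boff e μ j + faβ e (bd₁ μ γ j) (bd₂ μ γ j) b) := by
  fin_cases j <;> cases b <;> simp [boff, faβ, bd₁]

/-- **EVERY ROW OFFSET OF THE WILSON STENCIL IS IN THE ALPHABET**: each `wα e γ i` is one of `0, e γ, e μ, −e μ, e γ − e μ`. [folklore] -/
theorem isOffset_wα (e : D → Λ) (γ : D) : ∀ i, IsOffset e γ (wα e γ i) := by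
  rintro (((b | ⟨μ, b⟩) | ⟨μ, b⟩) | ((⟨μ, j, i⟩ | ⟨μ, j, i⟩) | ⟨μ, j, b⟩))
  · cases b <;> simp [wα, curα]
  · cases b <;> simp [wα, spα]
  · simp [wα]
  · exact isOffset_bsα_di e γ μ j i
  · exact isOffset_bsα_tr e γ μ j i
  · exact isOffset_bsα_fa e γ μ j b

/-- **EVERY COLUMN OFFSET OF THE WILSON STENCIL IS IN THE ALPHABET**: each `wβ e γ i` is one of `0, e γ, e μ, −e μ, e γ − e μ`.
[folklore] -/
theorem isOffset_wβ (e : D → Λ) (γ : D) : ∀ i, IsOffset e γ (wβ e γ i) := by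
  rintro (((b | ⟨μ, b⟩) | ⟨μ, b⟩) | ((⟨μ, j, i⟩ | ⟨μ, j, i⟩) | ⟨μ, j, b⟩))
  · cases b <;> simp [wβ, curβ]
  · cases b <;> simp [wβ, spα]
  · cases b <;> simp [wβ, dvβ]
  · exact isOffset_bsβ_di e γ μ j i
  · exact isOffset_bsβ_tr e γ μ j i
  · exact isOffset_bsβ_fa e γ μ j b

end Offsets

/-! ## §4 Corollaries: entries, finite range, translation covariance -/

section Corollaries

variable {Λ : Type*} [DecidableEq Λ] [AddCommGroup Λ] {C : Type*} {D : Type*} [Fintype D] [DecidableEq D]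

/-- ENTRIES of the Wilson vertex as a finite sum over the stencil index. [folklore] -/
theorem wilsonVertex₁_apply (e : D → Λ) (z : Λ) (γ : D) (A : Matrix C C ℝ) (p q : Λ × (C × D)) :
    wilsonVertex₁ e z γ A p q = ∑ i, if p.1 = z + wα e γ i ∧ q.1 = z + wβ e γ i then wm γ A i p.2 q.2 else 0 := by
  rw [wilsonVertex₁_eq_stencil, stencilIns_apply]

/-- **FINITE RANGE (rows)**: an entry of `wilsonVertex₁ e z γ A` whose row site is none of the sites `z + wα e γ i` vanishes. [folklore] -/
theorem wilsonVertex₁_apply_eq_zero_of_row (e : D → Λ) (z : Λ) (γ : D) (A : Matrix C C ℝ) {p : Λ × (C × D)} (q : Λ × (C × D))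
    (h : ∀ i, p.1 ≠ z + wα e γ i) : wilsonVertex₁ e z γ A p q = 0 := by
  rw [wilsonVertex₁_eq_stencil]
  exact stencilIns_apply_eq_zero_of_row z univ _ _ _ q fun i _ => h i

/-- **FINITE RANGE (columns)**: an entry whose column site is none of the sites `z + wβ e γ i` vanishes. [folklore] -/
theorem wilsonVertex₁_apply_eq_zero_of_col (e : D → Λ) (z : Λ) (γ : D) (A : Matrix C C ℝ) (p : Λ × (C × D)) {q : Λ × (C × D)}
    (h : ∀ i, q.1 ≠ z + wβ e γ i) : wilsonVertex₁ e z γ A p q = 0 := by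
  rw [wilsonVertex₁_eq_stencil]
  exact stencilIns_apply_eq_zero_of_col z univ _ _ _ p fun i _ => h i

/-- **LATTICE-TRANSLATION COVARIANCE**: the vertex of the translated bond `(z + a, γ)` is the vertex of `(z, γ)` read at the
back-translated sites. [folklore] -/
theorem wilsonVertex₁_translate (e : D → Λ) (z a : Λ) (γ : D) (A : Matrix C C ℝ) (p q : Λ × (C × D)) :
    wilsonVertex₁ e (z + a) γ A p q = wilsonVertex₁ e z γ A (p.1 - a, p.2) (q.1 - a, q.2) := by
  rw [wilsonVertex₁_eq_stencil, wilsonVertex₁_eq_stencil, stencilIns_translate]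

/-- **FINITE RANGE IN THE ALPHABET**: a non-zero entry of `wilsonVertex₁ e z γ A` has row site `z + x` and column site `z + y` with
`x`, `y` in the offset alphabet (each a signed combination of at most two lattice vectors). [folklore] -/
theorem wilsonVertex₁_apply_ne_zero (e : D → Λ) (z : Λ) (γ : D) (A : Matrix C C ℝ) {p q : Λ × (C × D)}
    (h : wilsonVertex₁ e z γ A p q ≠ 0) :
    (∃ x, IsOffset e γ x ∧ p.1 = z + x) ∧ ∃ y, IsOffset e γ y ∧ q.1 = z + y := by
  refine ⟨?_, ?_⟩
  · by_contra hc
    exact h (wilsonVertex₁_apply_eq_zero_of_row e z γ A q fun i hi => hc ⟨_, isOffset_wα e γ i, hi⟩)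
  · by_contra hc
    exact h (wilsonVertex₁_apply_eq_zero_of_col e z γ A p fun i hi => hc ⟨_, isOffset_wβ e γ i, hi⟩)

end Corollaries

/-! ## §5 Sanity examples -/

section Examples

variable {Λ : Type*} [DecidableEq Λ] [AddCommGroup Λ] {C : Type*} {D : Type*} [Fintype D] [DecidableEq D]

/-- sanity: the first index of the Wilson stencil is the current's far endpoint — row offset `e γ`, column offset `0`, block `copies D A`.
[folklore] -/
example (e : D → Λ) (γ : D) (A : Matrix C C ℝ) :
    wα e γ (Sum.inl (Sum.inl (Sum.inl true))) = e γ ∧ wβ e γ (Sum.inl (Sum.inl (Sum.inl true))) = 0 ∧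
      wm γ A (Sum.inl (Sum.inl (Sum.inl true))) = copies D A := by
  simp [wα, wβ, wm, curα, curβ, curM]

/-- sanity: the longitudinal vertex's second paired block sits at column offset `e γ − e μ` with block `−2 • dirBlock γ μ A`, and that
offset is in the alphabet. [folklore] -/
example (e : D → Λ) (γ μ : D) (A : Matrix C C ℝ) :
    wβ e γ (Sum.inl (Sum.inr (μ, false))) = e γ - e μ ∧ wm γ A (Sum.inl (Sum.inr (μ, false))) = -((2 : ℝ) • dirBlock γ μ A) ∧
      IsOffset e γ (wβ e γ (Sum.inl (Sum.inr (μ, false)))) :=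
  ⟨by simp [wβ, dvβ], by simp [wm, dvm], isOffset_wβ e γ _⟩

end Examples

end Literature.MathematicalPhysics.QuantumFieldTheory.Balaban1983to89.Beta.PlaquetteStencilData
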